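import Literature.NumberTheory.LFunctions.LargeValuesFourierDecay
import HarnessLib

/-!
# The `R`-function and the trigonometric polynomial `Ŵ` of a finite set of reals; `L²` and `L⁴` bounds (Guth–Maynard Lemmas 8.2, 8.3)

Topic `NumberTheory/LFunctions`, family RH. Part of the programme around the tree's named fact
`Literature.NumberTheory.LFunctions.zeroDensity_guth_maynard` (Guth–Maynard, Theorem 1.2), which
`LargeValuesAssembly.lean` reduces to Propositions 6.1, 10.1 and 11.1 of L. Guth, J. Maynard,
*New large value estimates for Dirichlet polynomials*, Ann. of Math. 203 (2026). The analysis of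
`S₃` (§§7–10, Proposition 10.1) and of the additive energy (§11, Proposition 11.1) is phrased in
terms of the function `R(v) = ∑_{t∈W} |v|^{it}` (eq. (7.2)) and the trigonometric polynomial
`Ŵ(τ) = ∑_{t∈W} e^{−2πitτ}`. This file introduces them (definitions with bodies) and PROVES the two
basic moment bounds of §8 in a generic form (arbitrary smooth compactly supported test function `Φ`,
explicit dependence on the separation / dilation parameter):

* `GuthMaynardRFunction.Rfun_eq_trigPoly` (`R(v) = Ŵ(−log|v|/2π)`), `Rfun_natCast_div`
  (`R(n/m) = ∑_t n^{it}m^{-it}`, the kernel of the double zeta sums of `DoubleZetaSumMajorant.lean`),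
  `norm_Rfun_le`, `norm_trigPoly_le` (`≤ |W|`);
* `integral_mul_normSq_trigPoly`: `∫ Φ|Ŵ|² = ∑_{t₁,t₂} Φ̂(t₁−t₂)`;
  `integral_mul_norm_pow_four_trigPoly`: `∫ Φ|Ŵ|⁴ = ∑_{t₁,…,t₄} Φ̂(t₁+t₂−t₃−t₄)`;
* **Lemma 8.2 (`L²` bound)** `L2_bound`: `|∫ Φ|Ŵ|²| ≤ C|W| + C|W|²δ^{-j}` for `δ`-separated `W`;
* **Lemma 8.3 (`L⁴` bound)** `L4_bound`: `|∫ Φ(τ/D)|Ŵ(τ)|⁴dτ| ≤ C D E₁(W) + C D^{1−j}|W|⁴` for `D ≥ 1`,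
  with `E₁(W) = #{(t₁,t₂,t₃,t₄) ∈ W⁴ : |t₁+t₂−t₃−t₄| ≤ 1}` the additive energy (eq. (2.3); the same
  expression as `GuthMaynardAssembly.addEnergy`).

(In the paper `Φ` is a bump with `Φ(τ/T^η)` majorising the range `|τ| ≪ 1`, `δ = T^ε`, `D = T^η`, and
the conclusions read `∫_{v≍1}|R(v)|²dv ≪_ε |W|`, `∫_{v≍1}|R(v)|⁴dv ⪅ E(W)`.) The Fourier decay input is
`GuthMaynardFourier.norm_fourier_le_of_iteratedDeriv` of `LargeValuesFourierDecay.lean`. No named fact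
is introduced; everything here is proved.

## References

* L. Guth, J. Maynard, *New large value estimates for Dirichlet polynomials*, Ann. of Math. (2)
  203 (2026), no. 2; arXiv:2405.20552 (2024): eq. (2.3), (7.2), §8 (Lemmas 8.2, 8.3 and their proofs).
-/

noncomputable section

open Real Set Filter Topology Complex MeasureTheory Finset
open scoped FourierTransform ContDiff

namespace Literature.NumberTheory.LFunctions

namespace GuthMaynardRFunction

open GuthMaynardFourier

/-! ## §1. The trigonometric polynomial `Ŵ` and the `R`-function -/

/-- `Ŵ(τ) := ∑_{t ∈ W} e^{−2πitτ}`, "the Fourier transform of the distribution with a delta function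
at each point of `W`". [cite: GuthMaynard2026, (7.2)] -/
def trigPoly (W : Finset ℝ) (τ : ℝ) : ℂ :=
  ∑ t ∈ W, Complex.exp (((-(2 * π * t * τ) : ℝ) : ℂ) * I)

/-- Guth–Maynard's `R(v) := ∑_{t ∈ W} |v|^{it}`. [cite: GuthMaynard2026, (7.2)] -/
def Rfun (W : Finset ℝ) (v : ℝ) : ℂ := ∑ t ∈ W, ePow (t * I) |v|

/-- `|Ŵ(τ)| ≤ |W|`. [folklore] -/
theorem norm_trigPoly_le (W : Finset ℝ) (τ : ℝ) : ‖trigPoly W τ‖ ≤ W.card := by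
  unfold trigPoly
  refine (norm_sum_le _ _).trans ?_
  have : ∀ t ∈ W, ‖Complex.exp (((-(2 * π * t * τ) : ℝ) : ℂ) * I)‖ ≤ 1 := fun t _ ↦ by
    rw [Complex.norm_exp_ofReal_mul_I]
  calc ∑ t ∈ W, ‖Complex.exp (((-(2 * π * t * τ) : ℝ) : ℂ) * I)‖ ≤ ∑ t ∈ W, (1 : ℝ) :=
        Finset.sum_le_sum this
    _ = W.card := by simp

/-- `|R(v)| ≤ |W|`. [cite: GuthMaynard2026, Section 8] -/
theorem norm_Rfun_le (W : Finset ℝ) (v : ℝ) : ‖Rfun W v‖ ≤ W.card := by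
  unfold Rfun
  refine (norm_sum_le _ _).trans ?_
  have : ∀ t ∈ W, ‖ePow (t * I) |v|‖ ≤ 1 := fun t _ ↦ by
    rw [ePow, Complex.norm_exp]
    have : ((Real.log |v| : ℂ) * ((t : ℂ) * I)).re = 0 := by simp [Complex.mul_re]
    rw [this, Real.exp_zero]
  calc ∑ t ∈ W, ‖ePow (t * I) |v|‖ ≤ ∑ t ∈ W, (1 : ℝ) := Finset.sum_le_sum this
    _ = W.card := by simp

/-- `R(v) = Ŵ(−log|v| / 2π)`. [cite: GuthMaynard2026, (7.2)] -/
theorem Rfun_eq_trigPoly (W : Finset ℝ) (v : ℝ) :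
    Rfun W v = trigPoly W (-Real.log |v| / (2 * π)) := by
  unfold Rfun trigPoly
  refine Finset.sum_congr rfl fun t _ ↦ ?_
  rw [ePow]
  congr 1
  have hπ : (π : ℝ) ≠ 0 := Real.pi_pos.ne'
  have : (-(2 * π * t * (-Real.log |v| / (2 * π))) : ℝ) = Real.log |v| * t := by
    field_simp
  rw [this]; push_cast; ring

/-- `R(n/m) = ∑_{t ∈ W} n^{it} m^{-it}` for `n, m ≥ 1`: the kernel of the double zeta sums
(`DoubleZetaSum.double_sum_eq`). [cite: GuthMaynard2026, Section 11] -/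
theorem Rfun_natCast_div (W : Finset ℝ) {n m : ℕ} (hn : n ≠ 0) (hm : m ≠ 0) :
    Rfun W ((n : ℝ) / m) = ∑ t ∈ W, (n : ℂ) ^ ((t : ℂ) * I) * (m : ℂ) ^ (-((t : ℂ) * I)) := by
  unfold Rfun
  have hn0 : (0 : ℝ) < n := by exact_mod_cast Nat.pos_of_ne_zero hn
  have hm0 : (0 : ℝ) < m := by exact_mod_cast Nat.pos_of_ne_zero hm
  refine Finset.sum_congr rfl fun t _ ↦ ?_
  rw [abs_of_pos (by positivity), div_eq_mul_inv, ePow_mul hn0 (by positivity), ePow_eq_cpow hn0]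
  have e : ePow ((t : ℂ) * I) ((m : ℝ)⁻¹) = (m : ℂ) ^ (-((t : ℂ) * I)) := by
    have h1 : ePow (-((t : ℂ) * I)) (m : ℝ) = (m : ℂ) ^ (-((t : ℂ) * I)) := by
      rw [ePow_eq_cpow hm0]; norm_cast
    rw [← h1, ePow, ePow, Real.log_inv]
    congr 1; push_cast; ring
  rw [e]; norm_cast

/-- `conj(e^{ix}) = e^{−ix}` for real `x`. [folklore] -/
theorem conj_cexp_ofReal_mul_I (x : ℝ) :
    (starRingEnd ℂ) (Complex.exp ((x : ℂ) * I)) = Complex.exp (((-x : ℝ) : ℂ) * I) := by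
  rw [← Complex.exp_conj, map_mul, Complex.conj_ofReal, Complex.conj_I]
  congr 1; push_cast; ring

/-- `|Ŵ(τ)|² = ∑_{t₁,t₂ ∈ W} e^{−2πi(t₁−t₂)τ}`. [cite: GuthMaynard2026, proof of Lemma 8.2] -/
theorem normSq_trigPoly (W : Finset ℝ) (τ : ℝ) :
    (((‖trigPoly W τ‖ ^ 2 : ℝ)) : ℂ) =
      ∑ t₁ ∈ W, ∑ t₂ ∈ W, Complex.exp (((-(2 * π * (t₁ - t₂) * τ) : ℝ) : ℂ) * I) := by
  rw [Complex.ofReal_pow, ← Complex.mul_conj', trigPoly, map_sum, Finset.sum_mul_sum]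
  refine Finset.sum_congr rfl fun t₁ _ ↦ Finset.sum_congr rfl fun t₂ _ ↦ ?_
  rw [conj_cexp_ofReal_mul_I, ← Complex.exp_add]
  congr 1; push_cast; ring

/-- `|Ŵ(τ)|⁴ = ∑_{t₁,t₂,t₃,t₄ ∈ W} e^{−2πi(t₁+t₂−t₃−t₄)τ}`. [cite: GuthMaynard2026, proof of Lemma 8.3] -/
theorem norm_pow_four_trigPoly (W : Finset ℝ) (τ : ℝ) :
    (((‖trigPoly W τ‖ ^ 4 : ℝ)) : ℂ) = ∑ t₁ ∈ W, ∑ t₂ ∈ W, ∑ t₃ ∈ W, ∑ t₄ ∈ W,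
      Complex.exp (((-(2 * π * (t₁ + t₂ - t₃ - t₄) * τ) : ℝ) : ℂ) * I) := by
  have h : (((‖trigPoly W τ‖ ^ 4 : ℝ)) : ℂ) =
      (((‖trigPoly W τ‖ ^ 2 : ℝ)) : ℂ) * (((‖trigPoly W τ‖ ^ 2 : ℝ)) : ℂ) := by
    push_cast; ring
  rw [h, normSq_trigPoly, Finset.sum_mul_sum]
  refine Finset.sum_congr rfl fun t₁ _ ↦ Finset.sum_congr rfl fun t₂ _ ↦ ?_
  rw [Finset.sum_mul_sum]
  refine Finset.sum_congr rfl fun t₃ _ ↦ Finset.sum_congr rfl fun t₄ _ ↦ ?_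
  rw [← Complex.exp_add]
  congr 1; push_cast; ring

/-! ## §2. Moments of `Ŵ` against a test function -/

/-- `∫ Φ(τ) e^{−2πixτ} dτ = Φ̂(x)` (Mathlib's `𝓕`). [folklore] -/
theorem integral_mul_cexp_eq_fourier (Φ : ℝ → ℂ) (x : ℝ) :
    ∫ τ, Φ τ * Complex.exp ((((-(2 * π * x * τ)) : ℝ) : ℂ) * I) = 𝓕 Φ x := by
  rw [Real.fourier_real_eq]
  refine integral_congr_ae (Eventually.of_forall fun τ ↦ ?_)
  simp only [Circle.smul_def, Real.fourierChar_apply, smul_eq_mul]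
  rw [mul_comm]
  congr 2; push_cast; ring

/-- `Φ(τ) e^{−2πixτ}` is integrable if `Φ` is. [folklore] -/
theorem integrable_mul_cexp {Φ : ℝ → ℂ} (hΦ : Integrable Φ) (x : ℝ) :
    Integrable (fun τ ↦ Φ τ * Complex.exp ((((-(2 * π * x * τ)) : ℝ) : ℂ) * I)) := by
  refine hΦ.mul_bdd (c := 1) (Continuous.aestronglyMeasurable (by fun_prop))
    (Eventually.of_forall fun τ ↦ ?_)
  rw [Complex.norm_exp_ofReal_mul_I]

/-- **`∫ Φ(τ)|Ŵ(τ)|² dτ = ∑_{t₁,t₂ ∈ W} Φ̂(t₁ − t₂)`** ("`∫ ψ₂(τ)|Ŵ(τ)|² dτ = ∑_{t₁,t₂} ψ̂₂(t₁ − t₂)`").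
[cite: GuthMaynard2026, proof of Lemma 8.2] -/
theorem integral_mul_normSq_trigPoly {Φ : ℝ → ℂ} (hΦ : Integrable Φ) (W : Finset ℝ) :
    ∫ τ, Φ τ * (((‖trigPoly W τ‖ ^ 2 : ℝ)) : ℂ) = ∑ t₁ ∈ W, ∑ t₂ ∈ W, 𝓕 Φ (t₁ - t₂) := by
  simp_rw [normSq_trigPoly, Finset.mul_sum]
  rw [integral_finsetSum _ (fun t₁ _ ↦ integrable_finsetSum _ fun t₂ _ ↦ integrable_mul_cexp hΦ _)]
  refine Finset.sum_congr rfl fun t₁ _ ↦ ?_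
  rw [integral_finsetSum _ (fun t₂ _ ↦ integrable_mul_cexp hΦ _)]
  exact Finset.sum_congr rfl fun t₂ _ ↦ integral_mul_cexp_eq_fourier Φ (t₁ - t₂)

/-- **`∫ Φ(τ)|Ŵ(τ)|⁴ dτ = ∑_{t₁,t₂,t₃,t₄ ∈ W} Φ̂(t₁ + t₂ − t₃ − t₄)`**.
[cite: GuthMaynard2026, proof of Lemma 8.3] -/
theorem integral_mul_norm_pow_four_trigPoly {Φ : ℝ → ℂ} (hΦ : Integrable Φ) (W : Finset ℝ) :
    ∫ τ, Φ τ * (((‖trigPoly W τ‖ ^ 4 : ℝ)) : ℂ) =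
      ∑ t₁ ∈ W, ∑ t₂ ∈ W, ∑ t₃ ∈ W, ∑ t₄ ∈ W, 𝓕 Φ (t₁ + t₂ - t₃ - t₄) := by
  simp_rw [norm_pow_four_trigPoly, Finset.mul_sum]
  rw [integral_finsetSum _ (fun t₁ _ ↦ integrable_finsetSum _ fun t₂ _ ↦
    integrable_finsetSum _ fun t₃ _ ↦ integrable_finsetSum _ fun t₄ _ ↦ integrable_mul_cexp hΦ _)]
  refine Finset.sum_congr rfl fun t₁ _ ↦ ?_
  rw [integral_finsetSum _ (fun t₂ _ ↦ integrable_finsetSum _ fun t₃ _ ↦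
    integrable_finsetSum _ fun t₄ _ ↦ integrable_mul_cexp hΦ _)]
  refine Finset.sum_congr rfl fun t₂ _ ↦ ?_
  rw [integral_finsetSum _ (fun t₃ _ ↦ integrable_finsetSum _ fun t₄ _ ↦ integrable_mul_cexp hΦ _)]
  refine Finset.sum_congr rfl fun t₃ _ ↦ ?_
  rw [integral_finsetSum _ (fun t₄ _ ↦ integrable_mul_cexp hΦ _)]
  exact Finset.sum_congr rfl fun t₄ _ ↦ integral_mul_cexp_eq_fourier Φ (t₁ + t₂ - t₃ - t₄)

/-! ## §3. The `L²` and `L⁴` bounds (Guth–Maynard Lemmas 8.2 and 8.3, generic form) -/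

/-- Decay of the Fourier transform of a smooth compactly supported test function:
`|Φ̂(ξ)| ≤ K₀` and `|Φ̂(ξ)| ≤ K_j |ξ|^{-j}`. [folklore] -/
theorem fourier_decay {Φ : ℝ → ℂ} (hΦ : ContDiff ℝ ∞ Φ) (hΦs : HasCompactSupport Φ) (j : ℕ) :
    ∃ K, 0 ≤ K ∧ (∀ ξ, ‖𝓕 Φ ξ‖ ≤ K) ∧ (∀ ξ, ξ ≠ 0 → ‖𝓕 Φ ξ‖ ≤ K / |ξ| ^ j) := by
  have h0 : Integrable Φ := hΦ.continuous.integrable_of_hasCompactSupport hΦs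
  have hj : Integrable (iteratedDeriv j Φ) :=
    (hΦ.continuous_iteratedDeriv j (by exact_mod_cast le_top)).integrable_of_hasCompactSupport
      (hasCompactSupport_iteratedDeriv hΦs j)
  refine ⟨max (∫ u, ‖Φ u‖) (∫ u, ‖iteratedDeriv j Φ u‖), le_max_of_le_left (integral_nonneg
    fun _ ↦ norm_nonneg _), fun ξ ↦ (norm_fourier_le_integral_norm Φ ξ).trans (le_max_left _ _),
    fun ξ hξ ↦ ?_⟩
  refine (norm_fourier_le_of_iteratedDeriv hΦ hΦs j hξ).trans ?_
  have h1 : |ξ| ^ j ≤ (2 * π * |ξ|) ^ j :=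
    pow_le_pow_left₀ (abs_nonneg _) (by nlinarith [Real.two_le_pi, abs_nonneg ξ]) j
  exact div_le_div₀ (le_max_of_le_left (integral_nonneg fun _ ↦ norm_nonneg _)) (le_max_right _ _)
    (pow_pos (abs_pos.mpr hξ) j) h1

/-- **Guth–Maynard Lemma 8.2 (`L²` bound), generic form.** For a smooth compactly supported test
function `Φ` and every `j` there is `C` such that for every finite `δ`-separated `W ⊂ ℝ`,
`|∫ Φ(τ)|Ŵ(τ)|² dτ| ≤ C|W| + C|W|²δ^{-j}`: the diagonal `t₁ = t₂` contributes `|W| Φ̂(0)`, and for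
`t₁ ≠ t₂`, `|Φ̂(t₁ − t₂)| ≪_j |t₁ − t₂|^{-j} ≤ δ^{-j}` ("Since `W` is `T^ε`-separated … the terms with
`t₁ ≠ t₂` are negligible. The terms with `t₁ = t₂` contribute `≪ |W|`"); with `R(v) = Ŵ(−log|v|/2π)`
this is `∫_{v≍1}|R(v)|² dv ≪_ε |W|`. [cite: GuthMaynard2026, Lemma 8.2] -/
theorem L2_bound {Φ : ℝ → ℂ} (hΦ : ContDiff ℝ ∞ Φ) (hΦs : HasCompactSupport Φ) (j : ℕ) :
    ∃ C, 0 ≤ C ∧ ∀ (W : Finset ℝ) (δ : ℝ), 0 < δ →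
      (∀ t ∈ W, ∀ t' ∈ W, t ≠ t' → δ ≤ |t - t'|) →
      ‖∫ τ, Φ τ * (((‖trigPoly W τ‖ ^ 2 : ℝ)) : ℂ)‖ ≤ C * W.card + C * (W.card : ℝ) ^ 2 / δ ^ j := by
  obtain ⟨K, hK0, hKb, hKd⟩ := fourier_decay hΦ hΦs j
  refine ⟨K, hK0, fun W δ hδ hsep ↦ ?_⟩
  classical
  have h0 : Integrable Φ := hΦ.continuous.integrable_of_hasCompactSupport hΦs
  rw [integral_mul_normSq_trigPoly h0]
  -- split each inner sum into the diagonal term and the rest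
  have hinner : ∀ t₁ ∈ W, ‖∑ t₂ ∈ W, 𝓕 Φ (t₁ - t₂)‖ ≤ K + (W.card : ℝ) * (K / δ ^ j) := by
    intro t₁ ht₁
    rw [← Finset.add_sum_erase W _ ht₁, sub_self]
    refine (norm_add_le _ _).trans (add_le_add (hKb 0) ?_)
    refine (norm_sum_le _ _).trans ?_
    have : ∀ t₂ ∈ W.erase t₁, ‖𝓕 Φ (t₁ - t₂)‖ ≤ K / δ ^ j := by
      intro t₂ ht₂
      have hne : t₁ ≠ t₂ := (Finset.ne_of_mem_erase ht₂).symm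
      have ht₂W : t₂ ∈ W := Finset.mem_of_mem_erase ht₂
      refine (hKd _ (sub_ne_zero.mpr hne)).trans ?_
      exact div_le_div_of_nonneg_left hK0 (pow_pos hδ j)
        (pow_le_pow_left₀ hδ.le (hsep t₁ ht₁ t₂ ht₂W hne) j)
    calc ∑ t₂ ∈ W.erase t₁, ‖𝓕 Φ (t₁ - t₂)‖ ≤ ∑ t₂ ∈ W.erase t₁, K / δ ^ j := Finset.sum_le_sum this
      _ = ((W.erase t₁).card : ℝ) * (K / δ ^ j) := by rw [Finset.sum_const, nsmul_eq_mul]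
      _ ≤ (W.card : ℝ) * (K / δ ^ j) := by
          gcongr
          exact Finset.erase_subset _ _
  calc ‖∑ t₁ ∈ W, ∑ t₂ ∈ W, 𝓕 Φ (t₁ - t₂)‖ ≤ ∑ t₁ ∈ W, ‖∑ t₂ ∈ W, 𝓕 Φ (t₁ - t₂)‖ := norm_sum_le _ _
    _ ≤ ∑ t₁ ∈ W, (K + (W.card : ℝ) * (K / δ ^ j)) := Finset.sum_le_sum hinner
    _ = K * W.card + K * (W.card : ℝ) ^ 2 / δ ^ j := by
        rw [Finset.sum_const, nsmul_eq_mul]; ring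

/-- **Guth–Maynard Lemma 8.3 (`L⁴` bound), generic form.** For a smooth compactly supported test
function `Φ` and every `j` there is `C` such that for every finite `W ⊂ ℝ` and `D ≥ 1`,
`|∫ Φ(τ/D)|Ŵ(τ)|⁴ dτ| ≤ C D E₁(W) + C D^{1−j}|W|⁴`, where
`E₁(W) = #{(t₁,t₂,t₃,t₄) ∈ W⁴ : |t₁+t₂−t₃−t₄| ≤ 1}` is the additive energy: indeed
`∫ Φ(τ/D)|Ŵ|⁴ = D ∑ Φ̂(D(t₁+t₂−t₃−t₄))` and `|Φ̂(Dx)| ≪_j (D|x|)^{-j}` ("we may restrict the summation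
to `|t₁+t₂−t₃−t₄| ≤ 1` at the cost of an `O_η(T^{-100})` error term. The remaining terms contribute
`≪ T^η E(W)`", with `D = T^η`). [cite: GuthMaynard2026, Lemma 8.3] -/
theorem L4_bound {Φ : ℝ → ℂ} (hΦ : ContDiff ℝ ∞ Φ) (hΦs : HasCompactSupport Φ) (j : ℕ) :
    ∃ C, 0 ≤ C ∧ ∀ (W : Finset ℝ) (D : ℝ), 1 ≤ D →
      ‖∫ τ, Φ (τ / D) * (((‖trigPoly W τ‖ ^ 4 : ℝ)) : ℂ)‖ ≤
        C * D * (((W ×ˢ W) ×ˢ (W ×ˢ W)).filter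
          (fun q : (ℝ × ℝ) × (ℝ × ℝ) ↦ |q.1.1 + q.1.2 - q.2.1 - q.2.2| ≤ 1)).card +
        C * D / D ^ j * (W.card : ℝ) ^ 4 := by
  obtain ⟨K, hK0, hKb, hKd⟩ := fourier_decay hΦ hΦs j
  refine ⟨K, hK0, fun W D hD ↦ ?_⟩
  classical
  have hD0 : 0 < D := by linarith
  have h0 : Integrable Φ := hΦ.continuous.integrable_of_hasCompactSupport hΦs
  have h0D : Integrable (fun τ ↦ Φ (τ / D)) := h0.comp_div hD0.ne'
  rw [integral_mul_norm_pow_four_trigPoly h0D]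
  simp_rw [fourier_comp_div Φ hD0]
  -- bound each term by `K D 𝟙[|x| ≤ 1] + K D / D^j`
  set good : Finset ((ℝ × ℝ) × (ℝ × ℝ)) := ((W ×ˢ W) ×ˢ (W ×ˢ W)).filter
    (fun q : (ℝ × ℝ) × (ℝ × ℝ) ↦ |q.1.1 + q.1.2 - q.2.1 - q.2.2| ≤ 1) with hgood
  have hterm : ∀ t₁ t₂ t₃ t₄ : ℝ, ‖(D : ℂ) * 𝓕 Φ (D * (t₁ + t₂ - t₃ - t₄))‖ ≤
      K * D * (if |t₁ + t₂ - t₃ - t₄| ≤ 1 then 1 else 0) + K * D / D ^ j := by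
    intro t₁ t₂ t₃ t₄
    rw [norm_mul, Complex.norm_real, Real.norm_of_nonneg hD0.le]
    split_ifs with hx
    · have := hKb (D * (t₁ + t₂ - t₃ - t₄))
      have : 0 ≤ K * D / D ^ j := by positivity
      nlinarith
    · push Not at hx
      have hx0 : D * (t₁ + t₂ - t₃ - t₄) ≠ 0 := by
        refine mul_ne_zero hD0.ne' fun h ↦ ?_
        rw [h, abs_zero] at hx; linarith
      have h1 := hKd _ hx0
      have h2 : K / |D * (t₁ + t₂ - t₃ - t₄)| ^ j ≤ K / D ^ j := by
        refine div_le_div_of_nonneg_left hK0 (by positivity) ?_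
        rw [abs_mul, abs_of_pos hD0, mul_pow]
        have : 1 ≤ |t₁ + t₂ - t₃ - t₄| ^ j := one_le_pow₀ hx.le
        have : 0 ≤ D ^ j := by positivity
        nlinarith
      calc D * ‖𝓕 Φ (D * (t₁ + t₂ - t₃ - t₄))‖ ≤ D * (K / D ^ j) := by gcongr; exact h1.trans h2
        _ = K * D * 0 + K * D / D ^ j := by ring
  -- sum up
  have hsum : ‖∑ t₁ ∈ W, ∑ t₂ ∈ W, ∑ t₃ ∈ W, ∑ t₄ ∈ W, (D : ℂ) * 𝓕 Φ (D * (t₁ + t₂ - t₃ - t₄))‖ ≤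
      ∑ t₁ ∈ W, ∑ t₂ ∈ W, ∑ t₃ ∈ W, ∑ t₄ ∈ W,
        (K * D * (if |t₁ + t₂ - t₃ - t₄| ≤ 1 then 1 else 0) + K * D / D ^ j) := by
    refine (norm_sum_le _ _).trans (Finset.sum_le_sum fun t₁ _ ↦ ?_)
    refine (norm_sum_le _ _).trans (Finset.sum_le_sum fun t₂ _ ↦ ?_)
    refine (norm_sum_le _ _).trans (Finset.sum_le_sum fun t₃ _ ↦ ?_)
    exact (norm_sum_le _ _).trans (Finset.sum_le_sum fun t₄ _ ↦ hterm t₁ t₂ t₃ t₄)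
  refine hsum.trans (le_of_eq ?_)
  -- evaluate the sum of indicators as the energy count
  have hcount : ∑ t₁ ∈ W, ∑ t₂ ∈ W, ∑ t₃ ∈ W, ∑ t₄ ∈ W,
      (if |t₁ + t₂ - t₃ - t₄| ≤ 1 then (1 : ℝ) else 0) = good.card := by
    rw [hgood, Finset.card_filter]
    push_cast
    rw [Finset.sum_product, Finset.sum_product]
    refine Finset.sum_congr rfl fun t₁ _ ↦ Finset.sum_congr rfl fun t₂ _ ↦ ?_
    rw [Finset.sum_product]
  simp only [Finset.sum_add_distrib, Finset.sum_const, nsmul_eq_mul, ← Finset.mul_sum]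
  rw [hcount]
  ring

end GuthMaynardRFunction

end Literature.NumberTheory.LFunctions

end
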